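import Summits.BirchSwinnertonDyer.BirchSwinnertonDyer.Theorems.AdditiveKolyvaginRoadBottomTransferKrizLiAtOne
import Literature.NumberTheory.EllipticCurves.HeegnerPointsProofs
import HarnessLib

/-!
# Route `AdditiveKolyvaginRoad`, crux KS′ `LevelKolyvaginSystemsAdditive` (item stmt-BirchSwinnertonDyer-21396):
# the LENDER's SEED from the log certificate — registered stub S5c `stub_lenderSeed` of line `epsilon_matched_retyping`
# (skeleton v4; cell `pub/bsd-wall`, lead `cruxlead-stmt-BirchSwinnertonDyer-21396`; `--supports stmt-BirchSwinnertonDyer-21396`)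

WHY. Skeleton v4 of the line builds the lender `E₀`'s level Kolyvagin system from its geometric bipartite datum (stub S5a,
W. Zhang 2014 §3/§8.1/Thm 4.3 in print at `p ∤ N₀`) by the landed RIGIDITY constructor
`AdditiveKoly.nonempty_levelKolyvaginSystemP_of_bipartite_of_seed`, which needs ONE seed. On the (γ)-avatar locus the seed is free:
the locus carries the log certificate «some Heegner point `y₀ ∈ E₀(K)` over `heegnerPointComplex Dt₀ H₀` with `β(H₀) = β₀` is not
`p`-divisible in `E₀(ℚ_p)` along `ιp`», and this file turns it into `c_{E₀}(1) ≠ 0` for EVERY conductor-one Kolyvagin–Heegner datum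
`d₀` on `(Dt₀, β₀, ι)`:

* `exists_heegnerPoint_over_derivedPoint_one_of_β` — width seat w3's `exists_heegnerPoint_over_derivedPoint_one` with the orientation
  exported: the datum's `y_K ∈ E₀(K)` (McCallum's Galois descent of `P(1)`) lies over `heegnerPointComplex Dt₀ H` for a Heegner datum `H`
  WITH `β(H) = β₀`.
* `stub_lenderSeed` — the registered stub VERBATIM: two Heegner data with the same `β` give the same complex point
  (`heegnerPointComplex_eq_of_β_eq_holds`, Gross 1984 §3), `ι` is injective on points (`Affine.Point.map_injective`), so the datum's
  `y_K` IS the certificate's `y₀`; a `p`-th root of `y₀` in `E₀(K)` would map to one in `E₀(ℚ_p)`; and `c(1) ≠ 0 ⟺ y_K ∉ p·E₀(K)`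
  (`kolyvaginClass_one_ne_zero_iff_not_exists_zsmul_eq`: `p ≥ 5`, `ρ̄_{E₀,p}` onto, `d_K < −4`, Heegner hypothesis for `N₀`).

HONEST FRAMING: theorems only; 0 definitions, 0 named facts, 0 `sorry`; E-side, unconditional. Closes nothing by itself (a stub of
the line); BSD is NOT proved by any of this.

References: [cite: GrossLMS1991, §4 (4.4)] [cite: McCallumLMS1991, Cor. 4.5] [cite: Gross1984, §3].
-/

set_option linter.dupNamespace false -- single-conjunct summit repeats the name by design

noncomputable section

open scoped Classical

namespace Summit.BirchSwinnertonDyer.BirchSwinnertonDyer.Theorems.AdditiveKoly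

open WeierstrassCurve NumberField IsDedekindDomain Field
  Literature.NumberTheory.EllipticCurves Literature.NumberTheory.EllipticCurves.ModularForms
  Literature.NumberTheory.GaloisRepresentations Summit.BirchSwinnertonDyer.Rank1Residual

variable (W₀ : WeierstrassCurve ℚ) [W₀.IsElliptic] [W₀.IsGloballyMinimal] [NeZero (W₀.conductorNorm ℤ)]
  (p : ℕ) [hp : Fact p.Prime] (K : Type) [Field K] [NumberField K]
  (Dt₀ : ModularParametrizationData W₀ (W₀.conductorNorm ℤ)) (β₀ : ℤ) (ι : K →+* ℂ)

omit [W₀.IsGloballyMinimal] hp in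
/-- **The Heegner point under `P(1)`, with its orientation.** For a conductor-one Kolyvagin–Heegner datum `d₀` on `(Dt₀, β₀, ι)`
(imaginary quadratic `K`, Heegner hypothesis for the level) there are `y_K ∈ E₀(K)` and a Heegner datum `H` of level `N₀` with
`β(H) = β₀` such that `y_K ↦ P(1)` in `E₀(K[1])` and `ι(y_K) = heegnerPointComplex Dt₀ H` — w3's
`exists_heegnerPoint_over_derivedPoint_one`, keeping `β(H) = β₀` in the conclusion. [cite: GrossLMS1991, §1, §4 (P₁ = y_K)]
[cite: Gross1984, §3] -/
theorem exists_heegnerPoint_over_derivedPoint_one_of_β (hK : IsImaginaryQuadratic K)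
    (hH : SatisfiesHeegnerHypothesis (W₀.conductorNorm ℤ) K) (d : KolyvaginHeegnerData Dt₀ β₀ ι 1) :
    ∃ (P₀ : (W₀.baseChange K).toAffine.Point) (H : HeegnerDatum (W₀.conductorNorm ℤ) (NumberField.discr K)),
      H.β = β₀ ∧
      WeierstrassCurve.Affine.Point.map (W' := W₀) (algebraMap K (ringClassField K ι 1)).toRatAlgHom P₀ = d.derivedPoint ∧
      WeierstrassCurve.Affine.Point.map ι.toRatAlgHom P₀ = heegnerPointComplex Dt₀ H := by
  obtain ⟨P₀, hP₀⟩ := McCallum1991.exists_map_eq_derivedPoint_one' hK d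
  obtain ⟨H, hHβ⟩ := exists_heegnerDatum (W₀.conductorNorm ℤ) hK.discr_neg d.dvd_sq_sub
  obtain ⟨e, he⟩ := heegnerPointOfConductor_one_galoisConj_holds (W₀.conductorNorm ℤ) W₀ K hK hH Dt₀ β₀ ι d H hHβ
  refine ⟨P₀, H, hHβ, hP₀, ?_⟩
  have hι : ι.toRatAlgHom = (ringClassField K ι 1).subtype.toRatAlgHom.comp
      (algebraMap K (ringClassField K ι 1)).toRatAlgHom := by
    ext x
    rfl
  rw [hι, ← WeierstrassCurve.Affine.Point.map_map, hP₀, d.derivedPoint_one, map_sum,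
    heegnerPointComplex, ← Finset.sum_coe_sort H.reps, ← Finset.sum_coe_sort d.S]
  exact Fintype.sum_equiv e _ _ fun s ↦ he s

/-- **Registered stub S5c `stub_lenderSeed` of line `epsilon_matched_retyping` (skeleton v4), VERBATIM: the lender's seed from
the log certificate.** Frame: `E₀ = W₀` globally minimal, `p ≥ 5`, `ρ̄_{E₀,p}` onto, `K` imaginary quadratic with `d_K < −4`, Heegner
hypothesis for `N₀`, `ιp : K →+* ℚ_p`. Certificate: a Heegner point `y₀ ∈ E₀(K)` over `heegnerPointComplex Dt₀ H₀`, `β(H₀) = β₀`, NOT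
`p`-divisible in `E₀(ℚ_p)` along `ιp`. Conclusion: `c_{E₀}(1) = d₀.kolyvaginClass _ 1 ≠ 0` for every conductor-one datum `d₀` on
`(Dt₀, β₀, ι)`. [cite: GrossLMS1991, §4 (4.4)] [cite: McCallumLMS1991, Cor. 4.5] [cite: Gross1984, §3] -/
theorem stub_lenderSeed (W₀ : WeierstrassCurve ℚ) [W₀.IsElliptic] [W₀.IsGloballyMinimal] [NeZero (W₀.conductorNorm ℤ)]
    (p : ℕ) [Fact p.Prime] (K : Type) [Field K] [NumberField K]
    (Dt₀ : ModularParametrizationData W₀ (W₀.conductorNorm ℤ)) (β₀ : ℤ) (ι : K →+* ℂ) (hp : 5 ≤ p)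
    (hs₀ : W₀.HasSurjectiveModNGaloisRep p) (hK : IsImaginaryQuadratic K) (hlt : NumberField.discr K < -4)
    (hH₀ : SatisfiesHeegnerHypothesis (W₀.conductorNorm ℤ) K) (ιp : K →+* ℚ_[p])
    (hcert : ∃ (H₀ : HeegnerDatum (W₀.conductorNorm ℤ) (NumberField.discr K)) (y₀ : (W₀.baseChange K).toAffine.Point),
      H₀.β = β₀ ∧ WeierstrassCurve.Affine.Point.map ι.toRatAlgHom y₀ = heegnerPointComplex Dt₀ H₀ ∧
        ¬ ∃ Q : (W₀.baseChange ℚ_[p]).toAffine.Point, (p : ℤ) • Q = X11b.padicPointOf W₀ p ιp y₀)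
    (d₀ : KolyvaginHeegnerData Dt₀ β₀ ι 1) : d₀.kolyvaginClass (Fact.out : p.Prime) 1 ≠ 0 := by
  obtain ⟨H₀, y₀, hβ, hy₀, hndiv⟩ := hcert
  obtain ⟨P₀, H, hHβ, hP₀, hP₀H⟩ := exists_heegnerPoint_over_derivedPoint_one_of_β W₀ K Dt₀ β₀ ι hK hH₀ d₀
  -- the two Heegner data have the same orientation, hence the same complex point; `ι` is injective on points
  have hPy : P₀ = y₀ := by
    apply WeierstrassCurve.Affine.Point.map_injective (f := ι.toRatAlgHom)
    rw [hP₀H, hy₀]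
    exact heegnerPointComplex_eq_of_β_eq_holds Dt₀ H H₀ (hHβ.trans hβ.symm)
  rw [kolyvaginClass_one_ne_zero_iff_not_exists_zsmul_eq W₀ p K Dt₀ β₀ ι hp hs₀ hK hlt hH₀ d₀ P₀ hP₀]
  rintro ⟨Q, hQ⟩
  refine hndiv ⟨X11b.padicPointOf W₀ p ιp Q, ?_⟩
  rw [← hPy, ← hQ]
  simp only [X11b.padicPointOf, map_zsmul]

end Summit.BirchSwinnertonDyer.BirchSwinnertonDyer.Theorems.AdditiveKoly

end
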